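import Summits.Ventures.PercRepro.RankLevelSetBiIndepSumPerElem
import Summits.Ventures.PercRepro.RankLevelSetBiIndepPerElemModel

/-! # RankLevelSetBiIndepTruncate — TRUNCATION PRESERVES THE PER-ELEMENT PROFILE INEQUALITY (★★) (night-1 g24;
dossier §36.9 c)

`truncateTo M k` is the truncation of a finite matroid `M` to rank at most `k`: `X` is independent iff it is
independent in `M` and `#X ≤ k` (built with `IndepMatroid.ofFinite`, as the cell's model matroid; the tree has no
truncation operator). Its bi-independent `r`-sets are exactly those of `M` when `r ≤ k` and `#E − r ≤ k`, and there
are none otherwise (`mem_biIndep_truncateTo_iff`): the profile of the truncation is a WINDOW of the profile of `M`.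
Hence (★★) passes from `M` to every truncation (`biIndepPerElem_truncateTo`): for `2j + 1 < #E` either both levels
`j, j + 1` lie in the window (then the counts are those of `M`) or the left-hand count is `0`.
With `RankLevelSetBiIndepSumPerElem` and `RankLevelSetBiIndepPerElemModel`: every truncation of a direct sum of
model matroids (in particular every truncation of a direct sum of uniform matroids, and night-3's «parallel classes ⊕
free points» with any truncation) satisfies (★★), the monotone form of its profile and the global level-wise form at
its tight layer, with no Lorentzian input. Axioms: standard. -/

namespace PercRepro

open Set Matroid

variable {α : Type}

/-! ## The truncation -/

/-- The independence predicate of the truncation: independent in `M` with at most `k` elements. -/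
def truncIndep (M : Matroid α) (k : ℕ) (X : Set α) : Prop := M.Indep X ∧ X.ncard ≤ k

/-- The augmentation axiom for `truncIndep` (finite ground set). -/
theorem truncIndep_aug (M : Matroid α) [M.Finite] (k : ℕ) {I J : Set α}
    (hI : truncIndep M k I) (hJ : truncIndep M k J) (hIJ : I.ncard < J.ncard) :
    ∃ e ∈ J, e ∉ I ∧ truncIndep M k (insert e I) := by
  obtain ⟨hIi, hIk⟩ := hI
  obtain ⟨hJi, hJk⟩ := hJ
  have hIfin : I.Finite := M.ground_finite.subset hIi.subset_ground
  have hJfin : J.Finite := M.ground_finite.subset hJi.subset_ground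
  have hIJ' : I.encard < J.encard := by
    rw [← hIfin.cast_ncard_eq, ← hJfin.cast_ncard_eq]
    exact_mod_cast hIJ
  obtain ⟨e, ⟨heJ, heI⟩, hins⟩ := hIi.augment hJi hIJ'
  refine ⟨e, heJ, heI, hins, ?_⟩
  rw [Set.ncard_insert_of_notMem heI hIfin]
  omega

/-- **The truncation of `M` to rank at most `k`**: `X` is independent iff it is `M`-independent with `#X ≤ k`. -/
noncomputable def truncateTo (M : Matroid α) [M.Finite] (k : ℕ) : Matroid α :=
  (IndepMatroid.ofFinite M.ground_finite (truncIndep M k)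
    ⟨M.empty_indep, by simp⟩
    (fun I J hJ hIJ => ⟨hJ.1.subset hIJ,
      (Set.ncard_le_ncard hIJ (M.ground_finite.subset hJ.1.subset_ground)).trans hJ.2⟩)
    (fun I J hI hJ hIJ => truncIndep_aug M k hI hJ hIJ)
    (fun I hI => hI.1.subset_ground)).matroid

/-- Independence in the truncation, unfolded. -/
theorem truncateTo_indep_iff (M : Matroid α) [M.Finite] (k : ℕ) (X : Set α) :
    (truncateTo M k).Indep X ↔ M.Indep X ∧ X.ncard ≤ k := Iff.rfl

/-- The ground set of the truncation is that of `M`. -/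
@[simp] theorem truncateTo_E (M : Matroid α) [M.Finite] (k : ℕ) : (truncateTo M k).E = M.E := rfl

/-- The truncation is finite (no `instance`: the cell's typer lint). -/
theorem truncateTo_finite (M : Matroid α) [M.Finite] (k : ℕ) : (truncateTo M k).Finite := ⟨M.ground_finite⟩

/-! ## The profile of a truncation is a window -/

/-- **Bi-independence in the truncation**: `S ∈ D_r(T_k M)` iff `S ∈ D_r(M)`, `r ≤ k` and `#E − r ≤ k`. -/
theorem mem_biIndep_truncateTo_iff (M : Matroid α) [M.Finite] (k r : ℕ) (S : Set α) :
    S ∈ biIndep (truncateTo M k) r ↔ S ∈ biIndep M r ∧ r ≤ k ∧ M.E.ncard - r ≤ k := by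
  constructor
  · rintro ⟨hSE, hr, ⟨hind, hk⟩, ⟨hind', hk'⟩⟩
    rw [truncateTo_E] at hSE hind' hk'
    refine ⟨⟨hSE, hr, hind, hind'⟩, by omega, ?_⟩
    rwa [Set.ncard_sdiff' hSE M.ground_finite, hr] at hk'
  · rintro ⟨⟨hSE, hr, hind, hind'⟩, hk, hk'⟩
    refine ⟨hSE, hr, ⟨hind, by omega⟩, ⟨hind', ?_⟩⟩
    rw [truncateTo_E, Set.ncard_sdiff' hSE M.ground_finite, hr]
    exact hk'

/-- The bi-independent `r`-sets of the truncation are those of `M` inside the window, and none outside. -/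
theorem biIndep_truncateTo (M : Matroid α) [M.Finite] (k r : ℕ) :
    biIndep (truncateTo M k) r = if r ≤ k ∧ M.E.ncard - r ≤ k then biIndep M r else ∅ := by
  ext S
  rw [mem_biIndep_truncateTo_iff]
  split_ifs with hw
  · exact ⟨fun h => h.1, fun h => ⟨h, hw.1, hw.2⟩⟩
  · simp only [Set.mem_empty_iff_false, iff_false]
    rintro ⟨-, h1, h2⟩
    exact hw ⟨h1, h2⟩

/-! ## Truncation preserves (★★) -/

/-- **Truncation preserves the per-element profile inequality**: `BiIndepPerElem M → BiIndepPerElem (T_k M)`. -/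
theorem biIndepPerElem_truncateTo (M : Matroid α) [M.Finite] (k : ℕ) (hM : BiIndepPerElem M) :
    haveI := truncateTo_finite M k
    BiIndepPerElem (truncateTo M k) := by
  haveI := truncateTo_finite M k
  intro y hy j hj
  rw [truncateTo_E] at hy hj
  rw [biIndep_truncateTo, biIndep_truncateTo]
  by_cases hw : j ≤ k ∧ M.E.ncard - j ≤ k
  · rw [if_pos hw]
    by_cases hw' : j + 1 ≤ k ∧ M.E.ncard - (j + 1) ≤ k
    · rw [if_pos hw']
      exact hM y hy j hj
    · -- `j + 1 > k` is impossible below the middle: `#E − j ≤ k = j` gives `#E ≤ 2j`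
      exfalso
      exact hw' ⟨by omega, by omega⟩
  · rw [if_neg hw]
    simp only [Set.mem_empty_iff_false, false_and, Set.setOf_false, Set.ncard_empty]
    exact Nat.zero_le _

/-- **The corollary on the model family**: every truncation of a direct sum of two model matroids satisfies (★★),
hence the monotone form of its profile (with `RankLevelSetBiIndepPerElem` the global level-wise form at its tight
layer) — no Lorentzian input. -/
theorem biIndepPerElem_truncateTo_disjointSum_model {E₁ E₂ : Set α} (hE₁ : E₁.Finite) (hE₂ : E₂.Finite)
    {F₁ F₂ : Set α} (hF₁ : F₁ ⊆ E₁) (hF₂ : F₂ ⊆ E₂) (q₁ p₁ q₂ p₂ k : ℕ) (h : Disjoint E₁ E₂) :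
    haveI := modelMatroid_finite hE₁ F₁ q₁ p₁
    haveI := modelMatroid_finite hE₂ F₂ q₂ p₂
    haveI : ((modelMatroid hE₁ F₁ q₁ p₁).disjointSum (modelMatroid hE₂ F₂ q₂ p₂) h).Finite :=
      ⟨by rw [Matroid.disjointSum_ground_eq]; exact hE₁.union hE₂⟩
    haveI := truncateTo_finite ((modelMatroid hE₁ F₁ q₁ p₁).disjointSum (modelMatroid hE₂ F₂ q₂ p₂) h) k
    BiIndepPerElem (truncateTo ((modelMatroid hE₁ F₁ q₁ p₁).disjointSum (modelMatroid hE₂ F₂ q₂ p₂) h) k) := by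
  haveI := modelMatroid_finite hE₁ F₁ q₁ p₁
  haveI := modelMatroid_finite hE₂ F₂ q₂ p₂
  haveI : ((modelMatroid hE₁ F₁ q₁ p₁).disjointSum (modelMatroid hE₂ F₂ q₂ p₂) h).Finite :=
    ⟨by rw [Matroid.disjointSum_ground_eq]; exact hE₁.union hE₂⟩
  exact biIndepPerElem_truncateTo _ k
    (biIndepPerElem_disjointSum (modelMatroid_biIndepPerElem hE₁ hF₁ q₁ p₁) (modelMatroid_biIndepPerElem hE₂ hF₂ q₂ p₂))

end PercRepro
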